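import Literature.AlgebraicGeometry.Resolution.EtaleChartRegularSubscheme
import Literature.AlgebraicGeometry.Resolution.CanonicalResolutionSpread
import Literature.AlgebraicGeometry.Resolution.CanonicalResolutionProofs
import Literature.AlgebraicGeometry.Resolution.RegularLocalRingsJacobian
import Mathlib.Topology.JacobsonSpace
import Mathlib.RingTheory.Spectrum.Prime.Jacobson
import HarnessLib

/-!
# Shaped resolutions of `(𝔸ⁿ_K, 𝓘_{V(S)}, ∅, 1)` in characteristic zero from Kollár's Theorem 3.69

Topic: `Literature/AlgebraicGeometry/Resolution`. The characteristic-zero half of the chain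
`BierstoneGrigorievMilmanWlodarczyk2011_embedded ⇐ …_canonical ⇐ (C0') ∧ (SP)`
(`CanonicalResolutionProofs.lean`, `CanonicalResolutionSpread.lean`), reduced here to Kollár's
inductive leaves `Kollar2007Thm3_103` / `Kollar2007Thm3_107` (`KollarBlowupSequenceFunctors.lean`)
exactly as the non-embedded fact was in `EffectiveResolutionKollarLeaves.lean`. All PROVED; no
definitions, no named facts.

(C0') — SHAPED resolutions of the marked ideals `(𝔸ⁿ_K, 𝓘_{V(S)}, ∅, 1)` over every field `K`
of characteristic ZERO, `∀ K [CharZero K] n S, HasShapedResolution K n S` (BGMW Thm. 4.0.6: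
existence, and (2) for the open immersions into the smooth region; the characteristic-zero input
`h0` of `canonical_of_charZero_of_spreads`, `CanonicalResolutionSpread.lean`) — is written OUT
here as the conclusion of `canonicalCharZero_of_kollarThms`; this file does not refer to the
pass-through name `BierstoneGrigorievMilmanWlodarczyk2011_canonicalCharZero` of (C0') (D-0026
review of that split child, 2026-08-15: its only possible discharge is this implication applied
to the two pre-existing Kollár leaves, so it is merged back into the implication, exactly as (C0)
`CharZeroMarkedResolution` was in `EffectiveResolutionSpread.lean`). (C0') asks, for
`(𝔸ⁿ_K, 𝓘_{V(S)}, ∅, 1)` over a field `K` of characteristic zero, for (i) a resolution `s`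
(BGMW Def. 3.1.3) such that (ii) if `V(S)` is integral, on every open `U` meeting `V(S)` inside
its regular locus, `s|U` is an extension of the single blow-up of `𝓘_{V(S)}|U`. Kollár's
Thm. 3.69 in every dimension (`Kollar2007.MarkedOrderReductionInDim`) provides functors `𝓑𝓜𝓞_1`;
`s := 𝓑𝓜𝓞_1(𝔸ⁿ_K, 𝓘_{V(S)}, ∅)` (the triple `Kollar2007.Triple.affineSpace`) satisfies (i), and
(ii) is the following computation of a VALUE of the functor from its functoriality 3.34.1 alone:

* `Kollar2007.comapLocalIso_eq_single_of_regular` — **on an open `U ⊆ 𝔸ⁿ_K` meeting the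
  integral `Z = V(P)` only in regular closed points, `𝓑𝓜𝓞_1(U, 𝓘_Z|U, ∅)` is the single
  blow-up of `Z ∩ U`**: its first centre `C` is a non-empty smooth subscheme of `Z ∩ U`; at a
  closed point of `C` the étale chart of `EtaleChartRegularSubscheme.lean` identifies
  `(D(G), 𝓘_Z)` with the pull-back of a coordinate subspace `(𝔸ⁿ, 𝓘_L)`, where the functor
  blows up `L` at once (`Kollar2007.affineSpace_linear_eq_single`), so by 3.34.1 (twice:
  along the chart and along `D(G) ↪ U`) `C` and `Z` agree on `D(G)`; non-closed points of `C`
  specialize to closed ones (`U` is Jacobson), so `C` is open in the irreducible `Z ∩ U`, hence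
  `C = Z ∩ U` (both are radical ideal sheaves), and after this blow-up nothing non-empty is left
  to blow up (`CentreSeq.cons_eq_single_of_isResolutionOf`);
* `hasShapedResolution_of_markedOrderReductionInDim` — **Thm. 3.69 in all dimensions (universe
  `0`) ⟹ (C0')** (3.34.1 for the open immersion `U ↪ 𝔸ⁿ`: `𝓑𝓜𝓞_1(U, …)` is the pruning of
  `s|U`, `CentreSeq.isExtensionOf_prune`);
* `canonicalCharZero_of_kollarThms` — **(C0') from `Kollar2007Thm3_103` and `Kollar2007Thm3_107`**
  (Kollár's induction 3.70, `Kollar2007Thm3_103.orderReduction`), with (C0') written out;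
* `canonical_of_kollarThms_of_spreads`, `embedded_of_kollarThms_of_spreads` — hence
  `BierstoneGrigorievMilmanWlodarczyk2011_canonical` and `…_embedded` from the two Kollár leaves
  and the spreading-out step `SpreadsShapedFromGenericPoint` (`canonical_of_charZero_of_spreads`,
  `bierstoneGrigorievMilmanWlodarczyk2011_embedded_of_canonical''`).

## Sources

* E. Bierstone, D. Grigoriev, P. Milman, J. Włodarczyk, *Effective Hironaka resolution and its
  complexity*, Asian J. Math. 15 (2011) (arXiv:1206.3090): Defs. 3.1.3–3.1.5, Thm. 4.0.6 and its
  proof for `𝓘 = 𝓘_Z` (pp. 6, 11–13), Thm. 8.0.5, Cor. 8.0.6 (p. 23).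
  [BierstoneGrigorievMilmanWlodarczyk2011]
* J. Kollár, *Lectures on Resolution of Singularities*, Ann. of Math. Stud. 166 (2007): 3.34.1
  (p. 131), Thm. 3.69 and 3.70 (p. 150), Thms. 3.103, 3.107. [Kollar2007]
-/

noncomputable section

open CategoryTheory CategoryTheory.Limits AlgebraicGeometry TopologicalSpace Topology

namespace Literature.AlgebraicGeometry.Resolution

universe u

/-! ## Regularity of `V(P)` at a point of `𝔸ⁿ`, ring-theoretically -/

section RegularPoint

variable {R : Type u} [CommRing R]

/-- If the stalk of `V(P) = Spec (R ⧸ P)` at the point `𝔪/P` (`𝔪 ⊇ P` prime) is a regular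
local ring, then so is `R_𝔪 / P R_𝔪` (`(R/P)_{𝔪/P} ≅ R_𝔪/P R_𝔪`). [folklore] -/
theorem isRegularLocalRing_localization_quotient_of_stalk (P 𝔪 : Ideal R) [𝔪.IsPrime]
    (hPm : P ≤ 𝔪)
    (y : Spec (CommRingCat.of (R ⧸ P)))
    (hy : Spec.map (CommRingCat.ofHom (Ideal.Quotient.mk P)) y =
      (⟨𝔪, inferInstance⟩ : PrimeSpectrum R))
    (hreg : IsRegularLocalRing ((Spec (CommRingCat.of (R ⧸ P))).presheaf.stalk y)) :
    IsRegularLocalRing (Localization.AtPrime 𝔪 ⧸ P.map (algebraMap R (Localization.AtPrime 𝔪))) := by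
  haveI : IsRegularLocalRing (Localization.AtPrime y.asIdeal) :=
    IsRegularLocalRing.of_ringEquiv (Spec.stalkIso (CommRingCat.of (R ⧸ P)) y).commRingCatIsoToRingEquiv
  have h := isRegularLocalRing_localization_quotient_map P y.asIdeal
  have hcomap : y.asIdeal.comap (Ideal.Quotient.mk P) = 𝔪 := by
    have := congrArg PrimeSpectrum.asIdeal hy
    rwa [Spec.map_apply] at this
  -- transport along the equality of primes
  clear hy hreg
  subst hcomap
  exact h

end RegularPoint

/-! ## The functor on an open of `𝔸ⁿ` meeting `Z = V(P)` in regular points -/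

section Core

open _root_.MvPolynomial Kollar2007

variable {K : Type u} [Field K] [CharZero K] {n : ℕ}

/-- The closed subscheme of the inverse image of the ideal sheaf `P̃` of a prime `P` along an
open immersion is reduced (it is an open subscheme of `V(P) ≅ Spec (R ⧸ P)`), hence the inverse
image ideal sheaf is radical. [folklore] -/
theorem radical_comap_idealSheaf_eq_of_isPrime {R : Type u} [CommRing R] (P : Ideal R) [P.IsPrime]
    {U : Scheme.{u}} (j : U ⟶ Spec (CommRingCat.of R)) [IsOpenImmersion j] :
    ((affineBlowup.idealSheaf P).comap j).radical = (affineBlowup.idealSheaf P).comap j := by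
  rw [← isReduced_subscheme_iff_radical_eq]
  -- `V(P̃) ≅ Spec (R ⧸ P)` is reduced
  haveI : IsClosedImmersion (Spec.map (CommRingCat.ofHom (Ideal.Quotient.mk P))) :=
    IsClosedImmersion.spec_of_surjective _ Ideal.Quotient.mk_surjective
  haveI hred : IsReduced (Spec.map (CommRingCat.ofHom (Ideal.Quotient.mk P))).ker.subscheme :=
    isReduced_of_isOpenImmersion (inv (Spec.map (CommRingCat.ofHom (Ideal.Quotient.mk P))).toImage)
  haveI : IsReduced (affineBlowup.idealSheaf P).subscheme := by
    have hker := ker_specMap_quotient_mk P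
    rw [← hker]
    exact hred
  -- and `V(j^*P̃) ≅ U ×_{𝔸ⁿ} V(P̃)` is an open subscheme of it
  haveI : IsReduced (pullback j (affineBlowup.idealSheaf P).subschemeι) :=
    isReduced_of_isOpenImmersion (pullback.snd j (affineBlowup.idealSheaf P).subschemeι)
  exact isReduced_of_isOpenImmersion ((affineBlowup.idealSheaf P).comapIso j).hom

/-- The support of `j^*P̃` is `j⁻¹ V(P)`. [folklore] -/
theorem support_comap_idealSheaf {R : Type u} [CommRing R] (P : Ideal R)
    {U : Scheme.{u}} (j : U ⟶ Spec (CommRingCat.of R)) :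
    (((affineBlowup.idealSheaf P).comap j).support : Set U) =
      j ⁻¹' PrimeSpectrum.zeroLocus (P : Set R) := by
  rw [Scheme.IdealSheafData.support_comap, TopologicalSpace.Closeds.coe_preimage,
    affineBlowup.support_idealSheaf]

/-- **A closed subset of a preirreducible set which is relatively open near each of its points is
everything** (if non-empty): `C ⊆ Z` closed, `C ≠ ∅`, and every point of `C` has a neighbourhood
`O` with `Z ∩ O ⊆ C` force `C = Z` for preirreducible (hence preconnected) `Z`. [folklore] -/
theorem eq_of_isPreirreducible_of_forall_exists_isOpen {X : Type u} [TopologicalSpace X]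
    {Z C : Set X} (hZ : IsPreirreducible Z) (hCZ : C ⊆ Z) (hC : IsClosed C) (hne : C.Nonempty)
    (hloc : ∀ z ∈ C, ∃ O : Set X, IsOpen O ∧ z ∈ O ∧ Z ∩ O ⊆ C) : C = Z := by
  classical
  refine Set.Subset.antisymm hCZ ?_
  choose! O hOopen hzO hO using hloc
  set Obig : Set X := ⋃ z ∈ C, O z with hObig
  have hObig_open : IsOpen Obig := isOpen_biUnion fun z hz => hOopen z hz
  have hCO : C ⊆ Obig := fun z hz => Set.mem_biUnion hz (hzO z hz)
  have hZO : Z ∩ Obig ⊆ C := by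
    rintro y ⟨hyZ, hyO⟩
    rw [hObig, Set.mem_iUnion₂] at hyO
    obtain ⟨z, hz, hy⟩ := hyO
    exact hO z hz ⟨hyZ, hy⟩
  have hconn : _root_.IsPreconnected Z := hZ.isPreconnected
  by_contra hnot
  rw [Set.not_subset] at hnot
  obtain ⟨y, hyZ, hyC⟩ := hnot
  have hyO : y ∉ Obig := fun h => hyC (hZO ⟨hyZ, h⟩)
  have hcover : Z ⊆ C ∪ Obigᶜ := by
    intro w hw
    by_cases hwO : w ∈ Obig
    · exact Or.inl (hZO ⟨hw, hwO⟩)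
    · exact Or.inr hwO
  obtain ⟨c, hc⟩ := hne
  obtain ⟨w, -, hwC, hwO⟩ := isPreconnected_closed_iff.mp hconn _ _ hC
    hObig_open.isClosed_compl hcover ⟨c, hCZ hc, hc⟩ ⟨y, hyZ, hyO⟩
  exact hwO (hCO hwC)

/-- In a Jacobson space, a local property of a closed set `C` that holds near its closed points
holds near all its points (every point of `C` specializes to a closed point of `C`, and open
sets are stable under generization). [folklore] -/
theorem forall_exists_isOpen_of_closedPoints {X : Type u} [TopologicalSpace X] [JacobsonSpace X]
    {Z C : Set X} (hC : IsClosed C)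
    (hloc : ∀ z ∈ C, IsClosed ({z} : Set X) → ∃ O : Set X, IsOpen O ∧ z ∈ O ∧ Z ∩ O ⊆ C) :
    ∀ z ∈ C, ∃ O : Set X, IsOpen O ∧ z ∈ O ∧ Z ∩ O ⊆ C := by
  intro z hz
  obtain ⟨z', hz'cl, hz'closed⟩ := nonempty_inter_closedPoints (X := X)
    (Z := closure {z}) ⟨z, subset_closure rfl⟩ isClosed_closure.isLocallyClosed
  have hspec : z ⤳ z' := specializes_iff_mem_closure.mpr hz'cl
  obtain ⟨O, hO, hz'O, hOC⟩ := hloc z' (hspec.mem_closed hC hz) hz'closed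
  exact ⟨O, hO, hspec.mem_open hO hz'O, hOC⟩

/-- **The first centre agrees with `Z` near a closed point (the chart step).** Notation as in
`Kollar2007.comapLocalIso_eq_single_of_regular`; if `B(U, P̃|U, ∅)` starts by blowing up `C` and
`z ∈ V(C)` is a closed point of `U`, then `j⁻¹V(P) ∩ O ⊆ V(C)` for an open `O ∋ z`: at the closed
point `j z` of `𝔸ⁿ` the étale chart `D(G) → 𝔸ⁿ` (`exists_etale_chart_of_isRegularLocalRing_quotient`)
pulls `(𝔸ⁿ, 𝓘_L)` back to `(D(G), P̃)`, so by 3.34.1 `B(D(G), P̃, ∅)` is the single blow-up of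
`P̃|_{D(G)}` (`Kollar2007.affineSpace_linear_eq_single`), while by 3.34.1 along `D(G) ↪ U` its
first centre is `C|_{D(G)}`. [cite: Kollar2007, 3.34.1 (p. 131)] [cite: BierstoneGrigorievMilmanWlodarczyk2011, proof of Thm. 4.0.6 (pp. 11–13)] -/
theorem Kollar2007.comapLocalIso_head_eq_near_closedPoint
    (P : Ideal (MvPolynomial (Fin n) K)) (hP : P ≠ ⊥)
    {U : Scheme.{u}} (j : U ⟶ Spec (CommRingCat.of (MvPolynomial (Fin n) K)))
    [IsOpenImmersion j] [QuasiCompact j]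
    (hreg : ∀ (𝔪 : Ideal (MvPolynomial (Fin n) K)) [h𝔪 : 𝔪.IsMaximal], P ≤ 𝔪 →
      (⟨𝔪, h𝔪.isPrime⟩ : PrimeSpectrum (MvPolynomial (Fin n) K)) ∈ Set.range j →
      IsRegularLocalRing (Localization.AtPrime 𝔪 ⧸
        P.map (algebraMap (MvPolynomial (Fin n) K) (Localization.AtPrime 𝔪))))
    {B : BlowupSequenceFunctor.{u} n}
    (hB : ∀ T : Triple K n, (B T).IsResolutionOf (T.marked 1) ∧ (B T).NoEmptyCentres)
    (hBs : CommutesWithSmoothMorphisms (TripleClass.all n) B)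
    {C : U.IdealSheafData} {rest : CentreSeq (blowup C)}
    (hBT : B ((Triple.affineSpace P hP).comapLocalIso j) = CentreSeq.cons C rest)
    {z : U} (hzC : z ∈ (C.support : Set U)) (hzcl : IsClosed ({z} : Set U))
    (hzP : P ≤ (j z).asIdeal) :
    ∃ O : Set U, IsOpen O ∧ z ∈ O ∧
      (j ⁻¹' PrimeSpectrum.zeroLocus (P : Set (MvPolynomial (Fin n) K))) ∩ O ⊆ C.support := by
  classical
  set T : Triple K n := Triple.affineSpace P hP with hTdef
  set TU : Triple K n := T.comapLocalIso j with hTUdef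
  -- `x = j z` is a closed point of `𝔸ⁿ`: a maximal ideal `𝔪 ⊇ P`
  haveI : JacobsonSpace (Spec (CommRingCat.of (MvPolynomial (Fin n) K))) :=
    inferInstanceAs (JacobsonSpace (PrimeSpectrum (MvPolynomial (Fin n) K)))
  set x : Spec (CommRingCat.of (MvPolynomial (Fin n) K)) := j z with hxdef
  have hxclosed : IsClosed ({x} : Set (Spec (CommRingCat.of (MvPolynomial (Fin n) K)))) := by
    have h2 := j.isOpenEmbedding.preimage_closedPoints
    have h3 : z ∈ j ⁻¹' closedPoints _ := by
      rw [h2]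
      exact hzcl
    exact h3
  haveI h𝔪 : x.asIdeal.IsMaximal :=
    (PrimeSpectrum.isClosed_singleton_iff_isMaximal x).mp hxclosed
  -- the étale chart at `x`, inside `j(U)`
  obtain ⟨G, s, Φ, hG𝔪, hs, hGW, hEt, hIdeal⟩ :=
    exists_etale_chart_of_isRegularLocalRing_quotient P hP x.asIdeal hzP
      (hreg x.asIdeal hzP ⟨z, rfl⟩) j.opensRange ⟨z, rfl⟩
  set ιG := Spec.map (CommRingCat.ofHom
    (algebraMap (MvPolynomial (Fin n) K) (Localization.Away G))) with hιGdef
  set φ : Spec (CommRingCat.of (MvPolynomial (Fin n) K)) ⟶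
      Spec (CommRingCat.of (MvPolynomial (Fin n) K)) :=
    Spec.map (CommRingCat.ofHom (Φ : MvPolynomial (Fin n) K →+* MvPolynomial (Fin n) K))
    with hφdef
  have hrange : Set.range ιG =
      (PrimeSpectrum.basicOpen G : Set (PrimeSpectrum (MvPolynomial (Fin n) K))) :=
    range_specMap_algebraMap_away G
  have hxG : x ∈ Set.range ιG := by
    rw [hrange]
    exact hG𝔪
  -- `l : D(G) ↪ U`
  have hsubU : Set.range ιG ⊆ Set.range j := fun y hy => hGW hy
  set l : Spec (CommRingCat.of (Localization.Away G)) ⟶ U := IsOpenImmersion.lift j ιG hsubU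
    with hldef
  have hl : l ≫ j = ιG := IsOpenImmersion.lift_fac _ _ _
  haveI : IsOpenImmersion (l ≫ j) := by
    rw [hl]
    infer_instance
  haveI : IsOpenImmersion l := IsOpenImmersion.of_comp l j
  obtain ⟨w, hw⟩ := hxG
  have hlw : l w = z := by
    apply j.isOpenEmbedding.injective
    rw [← Scheme.Hom.comp_apply, hl, hw]
  -- the triples on `D(G)` and on the linear model
  set TO : Triple K n := T.comapLocalIso ιG with hTOdef
  have hTOideal : TO.ideal = (affineBlowup.idealSheaf P).comap ιG := rfl
  set TL : Triple K n := Triple.affineSpace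
    (Ideal.span (MvPolynomial.X '' s : Set (MvPolynomial (Fin n) K))) (span_X_image_ne_bot hs)
    with hTLdef
  have hpbU : TU.IsPullbackAlong TO l := by
    refine ⟨?_, ?_, rfl⟩
    · change l ≫ j ≫ T.struct = ιG ≫ T.struct
      rw [← Category.assoc, hl]
    · change (affineBlowup.idealSheaf P).comap ιG = ((affineBlowup.idealSheaf P).comap j).comap l
      rw [← Scheme.IdealSheafData.comap_comp, hl]
  have hpbL : TL.IsPullbackAlong TO (ιG ≫ φ) := by
    -- (the boundary component is `[] = [].map _`; we rewrite with `List.map_nil` rather than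
    -- closing it by `rfl`, whose kernel check would compare the two morphisms)
    refine ⟨?_, ?_, ?_⟩
    rotate_left 2
    · show (([] : List (Spec (CommRingCat.of (MvPolynomial (Fin n) K))).IdealSheafData).map
          fun D => D.comap ιG) =
        ([] : List (Spec (CommRingCat.of (MvPolynomial (Fin n) K))).IdealSheafData).map
          fun D => D.comap (ιG ≫ φ)
      simp only [List.map_nil]
    · change (ιG ≫ φ) ≫ Spec.map (CommRingCat.ofHom (algebraMap K (MvPolynomial (Fin n) K))) =
        ιG ≫ Spec.map (CommRingCat.ofHom (algebraMap K (MvPolynomial (Fin n) K)))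
      have hφK : φ ≫ Spec.map (CommRingCat.ofHom (algebraMap K (MvPolynomial (Fin n) K))) =
          Spec.map (CommRingCat.ofHom (algebraMap K (MvPolynomial (Fin n) K))) := by
        rw [hφdef, ← Spec.map_comp, ← CommRingCat.ofHom_comp, Φ.comp_algebraMap]
      rw [Category.assoc, hφK]
    · change (affineBlowup.idealSheaf P).comap ιG =
        (affineBlowup.idealSheaf
          (Ideal.span (MvPolynomial.X '' s : Set (MvPolynomial (Fin n) K)))).comap (ιG ≫ φ)
      rw [Scheme.IdealSheafData.comap_comp]
      exact hIdeal
  -- from the linear model `B(TO)` is the single blow-up of `TO.ideal` …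
  haveI : Smooth (ιG ≫ φ) := by
    haveI := hEt
    infer_instance
  have hBL : B TL = CentreSeq.single (affineBlowup.idealSheaf
      (Ideal.span (MvPolynomial.X '' s : Set (MvPolynomial (Fin n) K)))) :=
    Kollar2007.affineSpace_linear_eq_single hs hB hBs
  have hTOne : TO.ideal ≠ ⊤ := by
    intro htop
    have : w ∈ ((TO.ideal).support : Set _) := by
      rw [hTOideal, Scheme.IdealSheafData.support_comap]
      change ιG w ∈ ((affineBlowup.idealSheaf P).support :
        Set (Spec (CommRingCat.of (MvPolynomial (Fin n) K))))
      rw [hw, affineBlowup.support_idealSheaf]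
      exact hzP
    rw [htop, Scheme.IdealSheafData.support_top] at this
    exact this
  have hBO₁ : B TO = CentreSeq.single TO.ideal := by
    have h := (hBs TL TO (ιG ≫ φ) trivial trivial hpbL).2
    rw [hBL, CentreSeq.comap_single] at h
    rw [h, show (affineBlowup.idealSheaf
        (Ideal.span (MvPolynomial.X '' s : Set (MvPolynomial (Fin n) K)))).comap (ιG ≫ φ) =
          TO.ideal from hpbL.ideal_eq.symm]
    change (CentreSeq.cons TO.ideal (CentreSeq.nil _)).prune = _
    rw [CentreSeq.prune_cons_of_ne_top hTOne, CentreSeq.prune_nil]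
    rfl
  -- … and from `U` its first centre is `C|_{D(G)}`
  have hClne : C.comap l ≠ ⊤ := by
    intro htop
    have : w ∈ ((C.comap l).support : Set _) := by
      rw [Scheme.IdealSheafData.support_comap]
      change l w ∈ (C.support : Set U)
      rw [hlw]
      exact hzC
    rw [htop, Scheme.IdealSheafData.support_top] at this
    exact this
  have hBO₂ : B TO = CentreSeq.cons (C.comap l) ((rest.comap (blowup.comapMap C l)).prune) := by
    have h := (hBs TU TO l trivial trivial hpbU).2
    rw [hBT, CentreSeq.comap_cons] at h
    rw [h, CentreSeq.prune_cons_of_ne_top hClne]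
  have hhead : TO.ideal = C.comap l := by
    have h := hBO₁.symm.trans hBO₂
    change CentreSeq.cons TO.ideal (CentreSeq.nil _) = _ at h
    exact (CentreSeq.cons.injEq _ _ _ _ ▸ h :).1
  -- conclusion on the open `l(D(G)) ∋ z`
  refine ⟨Set.range l, l.isOpenEmbedding.isOpen_range, ⟨w, hlw⟩, ?_⟩
  rintro y ⟨hyZ, ⟨v, rfl⟩⟩
  have hv : v ∈ ((TO.ideal).support : Set _) := by
    rw [hTOideal, Scheme.IdealSheafData.support_comap]
    change ιG v ∈ ((affineBlowup.idealSheaf P).support :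
      Set (Spec (CommRingCat.of (MvPolynomial (Fin n) K))))
    rw [affineBlowup.support_idealSheaf, ← hl]
    exact hyZ
  rw [hhead, Scheme.IdealSheafData.support_comap] at hv
  exact hv

/-- **The value of Kollár's functor on an open of `𝔸ⁿ` along a regular integral subscheme.**
Let `K` have characteristic zero, `0 ≠ P ⊆ K[x₁, …, xₙ]` a prime, `T = (𝔸ⁿ_K, P̃, ∅)` the triple of
Notation 3.64, `j : U ↪ 𝔸ⁿ_K` a quasi-compact open immersion meeting `Z = V(P)` and such that `Z`
is regular at every CLOSED point of `Z ∩ j(U)`, and `B` a blow-up sequence functor on triples of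
dimension `n` whose values over `K` are resolutions without empty blow-ups of the marked ideals
`(X, I, 1, E)` and which commutes with smooth morphisms (Thm. 3.69 (1), 3.32, 3.34.1). Then
`B(U, P̃|U, ∅)` is the single blow-up of `P̃|U` — "the blow-up of `X` [along the smooth `Z`] …
defines a unique resolution" (BGMW, proof of Thm. 4.0.6 for `𝓘 = 𝓘_Z`), obtained from
functoriality: étale-locally at closed points `(U, Z)` is a coordinate subspace of `𝔸ⁿ`
(`Kollar2007.comapLocalIso_head_eq_near_closedPoint`), so the first centre is open and closed in
the irreducible `Z ∩ U` (`eq_of_isPreirreducible_of_forall_exists_isOpen`; non-closed points by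
`forall_exists_isOpen_of_closedPoints`, `U` being Jacobson), hence equal to it, both being
radical; and nothing non-empty is left to blow up (`CentreSeq.cons_eq_single_of_isResolutionOf`).
[cite: Kollar2007, 3.34.1 (p. 131) and Thm. 3.69 (p. 150)] [cite: BierstoneGrigorievMilmanWlodarczyk2011, proof of Thm. 4.0.6 (pp. 11–13)] -/
theorem Kollar2007.comapLocalIso_eq_single_of_regular
    (P : Ideal (MvPolynomial (Fin n) K)) [hPpr : P.IsPrime] (hP : P ≠ ⊥)
    {U : Scheme.{u}} (j : U ⟶ Spec (CommRingCat.of (MvPolynomial (Fin n) K)))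
    [IsOpenImmersion j] [QuasiCompact j]
    (hmeets : (j ⁻¹' PrimeSpectrum.zeroLocus (P : Set (MvPolynomial (Fin n) K))).Nonempty)
    (hreg : ∀ (𝔪 : Ideal (MvPolynomial (Fin n) K)) [h𝔪 : 𝔪.IsMaximal], P ≤ 𝔪 →
      (⟨𝔪, h𝔪.isPrime⟩ : PrimeSpectrum (MvPolynomial (Fin n) K)) ∈ Set.range j →
      IsRegularLocalRing (Localization.AtPrime 𝔪 ⧸
        P.map (algebraMap (MvPolynomial (Fin n) K) (Localization.AtPrime 𝔪))))
    {B : BlowupSequenceFunctor.{u} n}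
    (hB : ∀ T : Triple K n, (B T).IsResolutionOf (T.marked 1) ∧ (B T).NoEmptyCentres)
    (hBs : CommutesWithSmoothMorphisms (TripleClass.all n) B) :
    B ((Triple.affineSpace P hP).comapLocalIso j) =
      CentreSeq.single ((affineBlowup.idealSheaf P).comap j) := by
  classical
  set T : Triple K n := Triple.affineSpace P hP with hTdef
  set TU : Triple K n := T.comapLocalIso j with hTUdef
  obtain ⟨hres, hne⟩ := hB TU
  -- the support `Z_U = j⁻¹ V(P)` of the marked ideal
  set ZU : Set U := j ⁻¹' PrimeSpectrum.zeroLocus (P : Set (MvPolynomial (Fin n) K)) with hZUdef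
  have hsuppI : (((affineBlowup.idealSheaf P).comap j).support : Set U) = ZU :=
    support_comap_idealSheaf P j
  have hsuppM : (TU.marked 1).support = ZU := by
    rw [MarkedIdeal.support_of_mult_eq_one _ rfl]
    exact hsuppI
  -- first centre `C` and the rest
  obtain ⟨C, rest, hBT⟩ : ∃ (C : U.IdealSheafData) (rest : CentreSeq (blowup C)),
      B TU = CentreSeq.cons C rest := by
    match hBT : B TU with
    | CentreSeq.nil _ =>
      exfalso
      rw [hBT, CentreSeq.isResolutionOf_nil_iff, hsuppM] at hres
      exact hmeets.ne_empty hres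
    | CentreSeq.cons C rest => exact ⟨C, rest, rfl⟩
  have hres' := hres
  have hne' := hne
  rw [hBT] at hres' hne'
  have hadm := (CentreSeq.isAdmissibleFor_cons C rest _).mp hres'.1
  have hCZ : (C.support : Set U) ⊆ ZU := hsuppM ▸ hadm.1
  have hCne : (C.support : Set U).Nonempty := by
    rw [Set.nonempty_iff_ne_empty]
    intro h0
    apply hne'.1
    rw [← Scheme.IdealSheafData.support_eq_bot_iff]
    ext1
    exact h0
  -- `U` is Jacobson
  haveI : JacobsonSpace (Spec (CommRingCat.of (MvPolynomial (Fin n) K))) :=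
    inferInstanceAs (JacobsonSpace (PrimeSpectrum (MvPolynomial (Fin n) K)))
  haveI : JacobsonSpace U := JacobsonSpace.of_isOpenEmbedding j.isOpenEmbedding
  -- `C` and `Z_U` agree near every point of `C`
  have hlocal : ∀ z ∈ (C.support : Set U), ∃ O : Set U, IsOpen O ∧ z ∈ O ∧ ZU ∩ O ⊆ C.support := by
    refine forall_exists_isOpen_of_closedPoints C.support.isClosed fun z hzC hzcl => ?_
    have hzP : P ≤ (j z).asIdeal := by
      have h1 : j z ∈ PrimeSpectrum.zeroLocus (P : Set (MvPolynomial (Fin n) K)) := hCZ hzC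
      exact (PrimeSpectrum.mem_zeroLocus _ _).mp h1
    exact Kollar2007.comapLocalIso_head_eq_near_closedPoint P hP j hreg hB hBs hBT hzC hzcl hzP
  -- hence `C.support = Z_U`
  have hirr : IsPreirreducible ZU := by
    have hV : IsIrreducible (PrimeSpectrum.zeroLocus (P : Set (MvPolynomial (Fin n) K))) := by
      rw [PrimeSpectrum.isIrreducible_zeroLocus_iff_of_radical _ hPpr.isRadical]
      exact hPpr
    exact hV.2.preimage j.isOpenEmbedding
  have hCsupp : (C.support : Set U) = ZU :=
    eq_of_isPreirreducible_of_forall_exists_isOpen hirr hCZ C.support.isClosed hCne hlocal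
  -- hence `C = P̃|U` as ideal sheaves (both radical; `eq_of_radical_of_support_eq` of
  -- `KollarGlobalization.lean`)
  have hCeq : C = (affineBlowup.idealSheaf P).comap j := by
    refine eq_of_radical_of_support_eq ?_ (radical_comap_idealSheaf_eq_of_isPrime P j) ?_
    · exact (isReduced_subscheme_iff_radical_eq C).mp hadm.2.2.1.isReduced
    · ext1
      rw [hCsupp, hsuppI]
  -- and the sequence is the single blow-up
  subst hCeq
  rw [hBT]
  exact CentreSeq.cons_eq_single_of_isResolutionOf hres' hne'

end Core

/-! ## (C0'): shaped resolutions in characteristic zero, from Theorem 3.69 -/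

section Assembly

open _root_.MvPolynomial Kollar2007

/-- An open immersion into an affine scheme with Noetherian underlying space is quasi-compact
(its source is compact). [folklore] -/
theorem quasiCompact_of_isOpenImmersion_of_noetherianSpace {U X : Scheme.{u}} (j : U ⟶ X)
    [IsOpenImmersion j] [IsAffine X] [NoetherianSpace X] : QuasiCompact j := by
  rw [HasAffineProperty.iff_of_isAffine (P := @QuasiCompact)]
  exact ⟨(j.isOpenEmbedding.isInducing.isCompact_iff).mpr (NoetherianSpace.isCompact _)⟩

/-- **Thm. 3.69 in every dimension gives shaped resolutions of `(𝔸ⁿ_K, 𝓘_{V(S)}, ∅, 1)` in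
characteristic zero** (`HasShapedResolution`): the value `𝓑𝓜𝓞_1(𝔸ⁿ_K, (S)~, ∅)` is a resolution
(Thm. 3.69 (1)), and on an open `U` meeting the integral `V(S)` inside its regular locus its
restriction prunes to `𝓑𝓜𝓞_1(U, …)` (3.34.1), which is the single blow-up of `𝓘_{V(S)}|U`
(`Kollar2007.comapLocalIso_eq_single_of_regular`); for `(S) = 0` the single blow-up of `V(0) = 𝔸ⁿ`
serves (`CentreSeq.single_bot_isResolutionOf`).
[cite: Kollar2007, Thm. 3.69 (p. 150) and 3.34.1 (p. 131)] [cite: BierstoneGrigorievMilmanWlodarczyk2011, Thm. 4.0.6 and its proof (pp. 11–13)] -/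
theorem hasShapedResolution_of_markedOrderReductionInDim
    (h : ∀ n : ℕ, Kollar2007.MarkedOrderReductionInDim.{0} n)
    (K : Type) [Field K] [CharZero K] (n : ℕ) (S : Finset (MvPolynomial (Fin n) K)) :
    HasShapedResolution K n S := by
  classical
  set I : Ideal (MvPolynomial (Fin n) K) := Ideal.span (S : Set (MvPolynomial (Fin n) K)) with hI
  have hker : (affineZeroLocusι K n S).ker = affineBlowup.idealSheaf I := affineZeroLocusι_ker_eq K n S
  by_cases hI0 : I = ⊥
  · -- `V(S) = 𝔸ⁿ`: blow up everything
    refine ⟨CentreSeq.single ⊥, ?_, ?_⟩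
    · rw [hker, hI0, affineBlowup.idealSheaf_eq_bot_iff.mpr rfl]
      exact CentreSeq.single_bot_isResolutionOf (Scheme.isRegular_Spec _)
        (hasSNC_nil_of_isRegular (Scheme.isRegular_Spec _)) 1
    · intro _ U j _ _ _
      rw [hker, hI0, affineBlowup.idealSheaf_eq_bot_iff.mpr rfl, CentreSeq.restrict_single]
      exact CentreSeq.isExtensionOfSingle_single _
  · -- the functor `𝓑𝓜𝓞_1` on the triple `(𝔸ⁿ_K, (S)~, ∅)`
    obtain ⟨B, hB, hBs, -, -⟩ := h n 1 le_rfl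
    set T : Triple K n := Triple.affineSpace I hI0 with hT
    refine ⟨B T, ?_, ?_⟩
    · have := (hB T).1
      rwa [hker]
    · intro hint U j hj hmeets hreg
      rw [hker]
      -- `(S)` is prime
      haveI : IsDomain (MvPolynomial (Fin n) K ⧸ I) := by
        have := (affine_isIntegral_iff (CommRingCat.of (MvPolynomial (Fin n) K ⧸ I))).mp hint
        exact this
      haveI hIpr : I.IsPrime := (Ideal.Quotient.isDomain_iff_prime I).mp inferInstance
      haveI : NoetherianSpace (Spec (CommRingCat.of (MvPolynomial (Fin n) K))) :=
        inferInstanceAs (NoetherianSpace (PrimeSpectrum (MvPolynomial (Fin n) K)))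
      haveI : QuasiCompact j := quasiCompact_of_isOpenImmersion_of_noetherianSpace j
      -- hypotheses of the core theorem
      have hmeets' : (j ⁻¹' PrimeSpectrum.zeroLocus (I : Set (MvPolynomial (Fin n) K))).Nonempty := by
        obtain ⟨y, ⟨u, hu⟩⟩ := hmeets
        refine ⟨u, ?_⟩
        change j u ∈ PrimeSpectrum.zeroLocus (I : Set (MvPolynomial (Fin n) K))
        rw [hu, ← affineBlowup.support_idealSheaf I, ← hker]
        exact (affineZeroLocusι K n S).range_subset_ker_support ⟨y, rfl⟩
      have hreg' : ∀ (𝔪 : Ideal (MvPolynomial (Fin n) K)) [h𝔪 : 𝔪.IsMaximal], I ≤ 𝔪 →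
          (⟨𝔪, h𝔪.isPrime⟩ : PrimeSpectrum (MvPolynomial (Fin n) K)) ∈ Set.range j →
          IsRegularLocalRing (Localization.AtPrime 𝔪 ⧸
            I.map (algebraMap (MvPolynomial (Fin n) K) (Localization.AtPrime 𝔪))) := by
        intro 𝔪 h𝔪 hI𝔪 hrange
        haveI : 𝔪.IsPrime := h𝔪.isPrime
        -- the point `𝔪/I` of `V(S)`
        have hker' : RingHom.ker (Ideal.Quotient.mk I) ≤ 𝔪 := by rw [Ideal.mk_ker]; exact hI𝔪
        haveI : (𝔪.map (Ideal.Quotient.mk I)).IsPrime :=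
          Ideal.map_isPrime_of_surjective Ideal.Quotient.mk_surjective hker'
        let y : affineZeroLocus K n S := ⟨𝔪.map (Ideal.Quotient.mk I), inferInstance⟩
        have hy : affineZeroLocusι K n S y =
            (⟨𝔪, h𝔪.isPrime⟩ : PrimeSpectrum (MvPolynomial (Fin n) K)) := by
          change Spec.map (CommRingCat.ofHom (Ideal.Quotient.mk I)) y = _
          rw [Spec.map_apply]
          apply PrimeSpectrum.ext
          change (𝔪.map (Ideal.Quotient.mk I)).comap (Ideal.Quotient.mk I) = 𝔪
          rw [Ideal.comap_map_of_surjective _ Ideal.Quotient.mk_surjective,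
            ← RingHom.ker_eq_comap_bot, Ideal.mk_ker]
          exact sup_eq_left.mpr hI𝔪
        have hregy := hreg y (hy ▸ hrange)
        exact isRegularLocalRing_localization_quotient_of_stalk I 𝔪 hI𝔪 y hy hregy
      have hcore := Kollar2007.comapLocalIso_eq_single_of_regular I hI0 j hmeets' hreg'
        (fun T' => hB T') hBs
      -- 3.34.1 for `j`: `B(T|U)` is the pruning of `(B T)|U`
      have hcomm := (hBs T (T.comapLocalIso j) j trivial trivial (T.isPullbackAlong_comapLocalIso j)).2
      rw [hcore] at hcomm
      rw [CentreSeq.restrict_eq_comap, ← CentreSeq.isExtensionOf_single_iff, hcomm]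
      exact CentreSeq.isExtensionOf_prune _

/-- **(C0') from Kollár's two inductive steps 3.103 and 3.107** (induction 3.70,
`Kollar2007Thm3_103.orderReduction`, then `hasShapedResolution_of_markedOrderReductionInDim`):
for every field `K` of characteristic zero, every `n` and every finite `S ⊆ K[x₁, …, xₙ]`, the
marked ideal `(𝔸ⁿ_K, 𝓘_{V(S)}, ∅, 1)` has a shaped resolution (`HasShapedResolution`: BGMW
Thm. 4.0.6, existence and (2) for the open immersions into the smooth region, with the value of
the canonical resolution on a smooth centre) — the conclusion written OUT (it is, word for word,
the body of the former pass-through named fact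
`BierstoneGrigorievMilmanWlodarczyk2011_canonicalCharZero` of `CanonicalResolutionSpread.lean`,
D-0026 review 2026-08-15: merged back into this implication, whose application to the two
pre-existing leaves was its only possible discharge). After this
theorem the characteristic-zero input `h0` of `canonical_of_charZero_of_spreads` rests on exactly
the two named facts `Kollar2007Thm3_103`, `Kollar2007Thm3_107`.
[cite: Kollar2007, 3.70 with Thms. 3.103 (p. 171), 3.107 (p. 175); Thm. 3.69 (p. 150), 3.34.1 (p. 131)]
[cite: BierstoneGrigorievMilmanWlodarczyk2011, Thm. 4.0.6 (existence, (2)) and its proof (pp. 11–13)] -/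
theorem canonicalCharZero_of_kollarThms (h103 : Kollar2007Thm3_103.{0})
    (h107 : Kollar2007Thm3_107.{0}) (K : Type) [Field K] [CharZero K] (n : ℕ)
    (S : Finset (MvPolynomial (Fin n) K)) : HasShapedResolution K n S :=
  hasShapedResolution_of_markedOrderReductionInDim (fun n => (h103.orderReduction h107 n).2) K n S

/-- **`BierstoneGrigorievMilmanWlodarczyk2011_canonical` from Kollár's Thms. 3.103, 3.107 and the
spreading-out step** (`canonical_of_charZero_of_spreads`).
[cite: BierstoneGrigorievMilmanWlodarczyk2011, Thm. 8.0.5 with Cor. 8.0.6–8.0.7] [cite: Kollar2007, Thms. 3.103, 3.107] -/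
theorem canonical_of_kollarThms_of_spreads (h103 : Kollar2007Thm3_103.{0})
    (h107 : Kollar2007Thm3_107.{0}) (hSP : ∀ n d l : ℕ, SpreadsShapedFromGenericPoint n d l) :
    BierstoneGrigorievMilmanWlodarczyk2011_canonical :=
  canonical_of_charZero_of_spreads (canonicalCharZero_of_kollarThms h103 h107) hSP

/-- **`BierstoneGrigorievMilmanWlodarczyk2011_embedded` (BGMW Cor. 8.0.6, embedded form) from
Kollár's Thms. 3.103, 3.107 and the spreading-out step**: compose with
`bierstoneGrigorievMilmanWlodarczyk2011_embedded_of_canonical''` (`CanonicalResolutionProofs.lean`,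
no J-2 hypothesis). Hence `BierstoneGrigorievMilmanWlodarczyk2011_embedded_holds` is the term
`embedded_of_kollarThms_of_spreads Kollar2007Thm3_103_holds Kollar2007Thm3_107_holds
SpreadsShapedFromGenericPoint_holds` once those are discharged.
[cite: BierstoneGrigorievMilmanWlodarczyk2011, Cor. 8.0.6 with Thm. 8.0.5 and Thm. 2.0.2] [cite: Kollar2007, Thms. 3.103, 3.107] -/
theorem embedded_of_kollarThms_of_spreads (h103 : Kollar2007Thm3_103.{0})
    (h107 : Kollar2007Thm3_107.{0}) (hSP : ∀ n d l : ℕ, SpreadsShapedFromGenericPoint n d l) :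
    BierstoneGrigorievMilmanWlodarczyk2011_embedded :=
  bierstoneGrigorievMilmanWlodarczyk2011_embedded_of_canonical''
    (canonical_of_kollarThms_of_spreads h103 h107 hSP)

end Assembly

end Literature.AlgebraicGeometry.Resolution

end
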